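import Summits.BirchSwinnertonDyer.BirchSwinnertonDyer.Theorems.ByReductionTypeAtTwoRankOneAtTwoBigImageOddLocalOneDoorValuation
import Summits.BirchSwinnertonDyer.BirchSwinnertonDyer.Theorems.ByReductionTypeAtTwoRankOneAtTwoOneDoorLawCDefs
import Literature.NumberTheory.EllipticCurves.HeegnerHypothesisKroneckerProofs
import Literature.NumberTheory.EllipticCurves.NonEisensteinPrimeOfSurjective
import Literature.NumberTheory.EllipticCurves.AnalyticRankModularityProofs
import HarnessLib

/-!
# Route ByReductionTypeAtTwo, crux `RankOneAtTwoBigImageOddLocal` (stmt-BirchSwinnertonDyer-23715), LINE v8.6 `one_door_analytic`: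
# the one open conjecture AN-28c SPLIT INTO ITS TWO HALVES — exponent bookkeeping and losslessness of the split (route-independent part)

Lead prover seat `bsd-line-fkl-p1` g8 (2026-08-28), `--supports stmt-BirchSwinnertonDyer-23715`.  THEOREMS ONLY; nothing is asserted;
BSD is not proved by any of this.  This module imports NO route file (the crux-by-name composition over it is the companion
`…OneDoorHalvesAssembly.lean`).

The line of record v8.5 reduces the crux to four primary printed facts, the route's four rank-`0` cruxes and ONE conjecture, AN-28c
`DoorIndexLawFullCAtTwo` (`…OneDoorLawCDefs.lean`): at every non-vanishing door datum `2m + [Δ_W<0] = s_E + s_d + t + 2s + 2·v₂(c)`.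
APPEND #6 of that Defs module (p626076) states its two halves, `DoorIndexLawUpperCAtTwo` (AN-28c-U: `Ш`-side `≤` index-side, the
EULER-SYSTEM half = `Typed.MissingUpperBoundAt W 2` in door currency by the width seat's `doorValuationC_at`) and `DoorIndexLawLowerCAtTwo`
(AN-28c-L: index-side `≤` `Ш`-side, the CONVERSE half), both for EVERY exponent `m` of the Heegner point.  Here:

* `exists_unique_exponent_at_door` — at every door datum of an analytic-rank-one `W` (`d_K` door-admissible, `L(W^{(d_K)},1) ≠ 0`),
  modulo Gross–Zagier and Kolyvagin at `(N_W, W, K)` and the entire continuation: `rank E(K) = 1`, the `K`-rational Heegner point has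
  infinite order, and its exact `2`-divisibility exponent modulo torsion EXISTS and is UNIQUE (`exists_twoDivisibility_of_rankOne`, lead g6;
  `hasTwoDivisibilityUpToTorsion_unique`, width seat g8).  The Heegner hypothesis comes from door-admissibility (decomposition law, as in
  the width seat g7's `satisfiesHeegnerHypothesis_of_doorAdmissible`, re-derived privately here to keep this module out of the route
  file's import cone), `L'(E/K,1) ≠ 0` from `L(E/K,s) = L(E,s)·L(E^{(d_K)},s)`.
* `doorIndexLawFullCAtTwo_of_halves` / `doorIndexLawUpperCAtTwo_of_full` / `doorIndexLawLowerCAtTwo_of_full` /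
  `doorIndexLawFullCAtTwo_iff_halves` — **the split is LOSSLESS**: modulo Gross–Zagier, Kolyvagin and modularity as a newform,
  `AN-28c ⟺ AN-28c-U ∧ AN-28c-L`.

Why the split: the two halves fail for different reasons and have different literatures — the upper half is Kolyvagin's Euler-system
bound with the exact power of `2` (printed for odd `p` with surjective `ρ_{E,p}`: Kolyvagin 1990 Thm. A as Gross 1991 Thm. 1.3 gives only
«order dividing `t_{E/K}·I_K²`» with `2 ∣ t_{E/K}` allowed; the sharp bound and structure theorems are McCallum 1991 / Cha 2005 Thm. 3,
`p` odd — at `p = 2` complex conjugation acts unipotently on `E[2]` when `Δ_W < 0` and Gross's eigenspace decomposition «since `p` is odd»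
is unavailable), the lower half is the direction of Kolyvagin's conjecture / the rank-one `p`-converse (W. Zhang 2014, `p ≥ 5`) and of the
main-conjecture lower bound (Jetchev–Skinner–Wan 2017, `p` odd).  They are the E-side images of route GenusKolyvaginAtTwo's K-side stubs
`stub_upperBoundAtTwo` / `stub_lowerBoundAtTwo` of `KolyvaginExactAtTwo` (stmt-22137); REF2-PLACEMENT-v25 §3: both OPEN IN PRINT at `2`,
the reshape is bookkeeping.  Conditional by design.

References: [GrossZagier1986] Thm. I.6.3, V.§2; [GrossLMS1991] Thm. 1.3, Conj. 1.2, §3, §5; [Kolyvagin1990] Thm. A; [McCallumLMS1991] §5;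
[Zhang2014] Thm. 1.1; [JetchevSkinnerWan2017] Thm. 1.2.1.
-/

set_option autoImplicit false

noncomputable section

open scoped Classical

set_option linter.dupNamespace false

namespace Summit.BirchSwinnertonDyer.BirchSwinnertonDyer.Theorems.RankOneAtTwoOneDoor

open WeierstrassCurve NumberField IsDedekindDomain Rat.HeightOneSpectrum Literature.NumberTheory.EllipticCurves
  Literature.NumberTheory.EllipticCurves.ModularForms
  Literature.NumberTheory.EllipticCurves.KrizLi2019
  Literature.NumberTheory.EllipticCurves.Rank1Residual.Typed
  Summit.BirchSwinnertonDyer.Rank1Residual.F1Sign2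
  Summit.BirchSwinnertonDyer.Rank1Residual.F1Sign2.TranspositionDoor
  Summit.BirchSwinnertonDyer.Rank1Residual


/-! ### §0 Door-admissible ⇒ Heegner hypothesis (private re-derivation; the public theorem is the width seat g7's
`satisfiesHeegnerHypothesis_of_doorAdmissible` in `…OneDoorIndexLawOfKolyvaginExact.lean`, which lives in the route file's import cone) -/

-- adapted from Theorems/ByReductionTypeAtTwoRankOneAtTwoBigImageOddLocalOneDoorIndexLawOfKolyvaginExact.lean (fkl-p2 g7)
/-- A door-admissible discriminant satisfies the Heegner hypothesis for `N_W`: `d_K ≡ 1 (mod 8)` makes `2` split, and at an odd `ℓ ∣ N_W`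
the curve has bad reduction (`not_dvd_conductorNorm_of_hasGoodReductionAtPrime`), so `(d_K/ℓ) = 1` by admissibility; conclude by the
decomposition law `satisfiesHeegnerHypothesis_iff_kronecker`. [cite: Gross1984, §3 (Heegner hypothesis)] -/
private theorem heegnerHypothesis_of_doorAdmissible (W : WeierstrassCurve ℚ) [W.IsElliptic] [W.IsGloballyMinimal]
    (K : Type) [Field K] [NumberField K] (hK : IsImaginaryQuadratic K) (hadm : DoorAdmissible W (NumberField.discr K)) :
    SatisfiesHeegnerHypothesis (W.conductorNorm ℤ) K := by
  rw [satisfiesHeegnerHypothesis_iff_kronecker (W.conductorNorm ℤ) K hK.1]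
  intro p hp hpN
  refine ⟨fun _ => hadm.2.2.1, fun hp2 => hadm.2.2.2.2 p hp hp2 fun hF hgood => ?_⟩
  haveI := hF
  exact not_dvd_conductorNorm_of_hasGoodReductionAtPrime W hgood hpN

/-! ### §1 The exponent of the Heegner point at a door datum exists and is unique (modulo print) -/

/-- **Exponent bookkeeping at a door datum.**  `W/ℚ` globally minimal of analytic rank `1` (`hr`); `K` imaginary quadratic with `d_K`
door-admissible (`hadm`) and `L(W^{(d_K)},1) ≠ 0` (`hLt`); ANY parametrisation datum `Dt` of level `N_W`, `H`, `ι`, and `P ∈ E(K)` mapping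
to the complex Heegner point; published inputs Gross–Zagier (`hGZ`) and Kolyvagin (`hKo`) at `(N_W, W, K)` and the entire continuation
(`hmod`).  THEN `rank E(K) = 1`, `P` has infinite order, an exact `2`-divisibility exponent of `P` modulo torsion EXISTS, and it is UNIQUE.
Proof: door-admissible ⇒ Heegner hypothesis; `L'(E/K,1) = L'(E,1)·L(E^{(d_K)},1) ≠ 0`; Gross–Zagier ⇒ `ĥ(P) ≠ 0`; Kolyvagin ⇒ rank one;
then `exists_twoDivisibility_of_rankOne` and `hasTwoDivisibilityUpToTorsion_unique`.
[cite: GrossZagier1986, Thm. I.6.3 and V.§2] [cite: Gross1991, (1.1) and Thm. 1.3] -/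
theorem exists_unique_exponent_at_door (hmod : hasEntireLFunction_rat)
    (W : WeierstrassCurve ℚ) [W.IsElliptic] [W.IsGloballyMinimal] [NeZero (W.conductorNorm ℤ)] (hr : W.analyticRank = 1)
    (K : Type) [Field K] [NumberField K] (hK : IsImaginaryQuadratic K)
    (hGZ : gross_zagier (W.conductorNorm ℤ) W K) (hKo : kolyvagin (W.conductorNorm ℤ) W K)
    (hadm : DoorAdmissible W (NumberField.discr K))
    (hLt : (W.quadraticTwist (NumberField.discr K : ℚ)).entireLFunction 1 ≠ 0)
    (Dt : ModularParametrizationData W (W.conductorNorm ℤ))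
    (H : HeegnerDatum (W.conductorNorm ℤ) (NumberField.discr K)) (ι : K →+* ℂ)
    (P : (W.baseChange K).toAffine.Point)
    (hP : WeierstrassCurve.Affine.Point.map ι.toRatAlgHom P = heegnerPointComplex Dt H) :
    (W.baseChange K).mordellWeilRank = 1 ∧ ¬ IsOfFinAddOrder P ∧
      (∃ m : ℕ, HasTwoDivisibilityUpToTorsion W K P m) ∧
      (∀ m m' : ℕ, HasTwoDivisibilityUpToTorsion W K P m → HasTwoDivisibilityUpToTorsion W K P m' → m = m') := by
  haveI hEK : (W.baseChange K).IsElliptic := isElliptic_baseChange' W K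
  have hHN : SatisfiesHeegnerHypothesis (W.conductorNorm ℤ) K := heegnerHypothesis_of_doorAdmissible W K hK hadm
  have hL0 : W.entireLFunction 1 = 0 := entireLFunction_one_eq_zero_of_analyticRank_eq_one hr
  obtain ⟨-, hderiv⟩ := leadingLCoeff_eq_deriv_of_analyticRank_eq_one hr
  have hprod := lDerivEK_eq_deriv_mul W K hmod hL0
  have hLK : LDerivEK W K ≠ 0 := by rw [hprod]; exact mul_ne_zero hderiv hLt
  have hPH : IsHeegnerPoint (W.conductorNorm ℤ) W K P := ⟨Dt, H, ι, hP⟩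
  have hPinf : ¬ IsOfFinAddOrder P :=
    (lDerivEK_ne_zero_iff_not_isOfFinAddOrder W (W.conductorNorm ℤ) K hGZ hK hHN hPH).mp hLK
  obtain ⟨hrkK, -⟩ := hKo hK hHN hPH hPinf
  obtain ⟨gK, -, hgenK, huniqK, -⟩ := exists_generator_regulator_eq_of_mordellWeilRank_eq_one (W.baseChange K) hrkK
  obtain ⟨m, Q, hPQ, hQ⟩ := exists_twoDivisibility_of_rankOne (W.baseChange K) hgenK huniqK hPinf
  exact ⟨hrkK, hPinf, ⟨m, Q, hPQ, hQ⟩, fun m m' hm hm' => hasTwoDivisibilityUpToTorsion_unique W K hrkK P hm hm'⟩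

/-! ### §2 The split is lossless: AN-28c ⟺ AN-28c-U ∧ AN-28c-L (modulo Gross–Zagier, Kolyvagin, modularity) -/

/-- **AN-28c from its two halves**: at every door datum of the slice the exponent exists (`exists_unique_exponent_at_door`; Gross–Zagier
and Kolyvagin universally as in `S_pub4`, the entire continuation from modularity as a newform), and the two inequalities give the
identity (`doorIndexLaw_eq_of_halves`). Conditional by design. [cite: GrossLMS1991, Conj. 1.2 and §3] -/
theorem doorIndexLawFullCAtTwo_of_halves
    (hGZ : ∀ (N : ℕ) [NeZero N] (W : WeierstrassCurve ℚ) (K : Type) [Field K] [NumberField K], gross_zagier N W K)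
    (hKo : ∀ (N : ℕ) [NeZero N] (W : WeierstrassCurve ℚ) (K : Type) [Field K] [NumberField K], kolyvagin N W K)
    (hnf : exists_isNewformOf) (hU : DoorIndexLawUpperCAtTwo) (hL : DoorIndexLawLowerCAtTwo) : DoorIndexLawFullCAtTwo := by
  intro W _ _ _ hCM hsurj hT hc hr K _ _ hK hadm hLt Dt H ι P hP Wd _ _ Cd hWd
  have hmod : hasEntireLFunction_rat := hasEntireLFunction_rat_of_exists_isNewformOf hnf
  obtain ⟨-, -, ⟨m, hm⟩, -⟩ := exists_unique_exponent_at_door hmod W hr K hK (hGZ _ W K) (hKo _ W K) hadm hLt Dt H ι P hP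
  exact ⟨m, hm, le_antisymm (hL W hCM hsurj hT hc hr K hK hadm hLt Dt H ι P hP Wd Cd hWd m hm)
    (hU W hCM hsurj hT hc hr K hK hadm hLt Dt H ι P hP Wd Cd hWd m hm)⟩

/-- **AN-28c ⇒ AN-28c-U** (the exponent is unique in rank one, `exists_unique_exponent_at_door`). Conditional by design.
[cite: GrossLMS1991, Conj. 1.2 and §3] -/
theorem doorIndexLawUpperCAtTwo_of_full
    (hGZ : ∀ (N : ℕ) [NeZero N] (W : WeierstrassCurve ℚ) (K : Type) [Field K] [NumberField K], gross_zagier N W K)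
    (hKo : ∀ (N : ℕ) [NeZero N] (W : WeierstrassCurve ℚ) (K : Type) [Field K] [NumberField K], kolyvagin N W K)
    (hnf : exists_isNewformOf) (h : DoorIndexLawFullCAtTwo) : DoorIndexLawUpperCAtTwo := by
  intro W _ _ _ hCM hsurj hT hc hr K _ _ hK hadm hLt Dt H ι P hP Wd _ _ Cd hWd m hm
  have hmod : hasEntireLFunction_rat := hasEntireLFunction_rat_of_exists_isNewformOf hnf
  obtain ⟨-, -, -, huniq⟩ := exists_unique_exponent_at_door hmod W hr K hK (hGZ _ W K) (hKo _ W K) hadm hLt Dt H ι P hP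
  obtain ⟨m₀, hm₀, hlaw⟩ := h W hCM hsurj hT hc hr K hK hadm hLt Dt H ι P hP Wd Cd hWd
  obtain rfl : m₀ = m := huniq m₀ m hm₀ hm
  exact hlaw.ge

/-- **AN-28c ⇒ AN-28c-L** (the exponent is unique in rank one, `exists_unique_exponent_at_door`). Conditional by design.
[cite: GrossLMS1991, Conj. 1.2 and §3] -/
theorem doorIndexLawLowerCAtTwo_of_full
    (hGZ : ∀ (N : ℕ) [NeZero N] (W : WeierstrassCurve ℚ) (K : Type) [Field K] [NumberField K], gross_zagier N W K)
    (hKo : ∀ (N : ℕ) [NeZero N] (W : WeierstrassCurve ℚ) (K : Type) [Field K] [NumberField K], kolyvagin N W K)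
    (hnf : exists_isNewformOf) (h : DoorIndexLawFullCAtTwo) : DoorIndexLawLowerCAtTwo := by
  intro W _ _ _ hCM hsurj hT hc hr K _ _ hK hadm hLt Dt H ι P hP Wd _ _ Cd hWd m hm
  have hmod : hasEntireLFunction_rat := hasEntireLFunction_rat_of_exists_isNewformOf hnf
  obtain ⟨-, -, -, huniq⟩ := exists_unique_exponent_at_door hmod W hr K hK (hGZ _ W K) (hKo _ W K) hadm hLt Dt H ι P hP
  obtain ⟨m₀, hm₀, hlaw⟩ := h W hCM hsurj hT hc hr K hK hadm hLt Dt H ι P hP Wd Cd hWd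
  obtain rfl : m₀ = m := huniq m₀ m hm₀ hm
  exact hlaw.le

/-- **The split of AN-28c into its halves is LOSSLESS** modulo Gross–Zagier, Kolyvagin and modularity as a newform:
`DoorIndexLawFullCAtTwo ↔ DoorIndexLawUpperCAtTwo ∧ DoorIndexLawLowerCAtTwo`. Conditional by design.
[cite: GrossLMS1991, Conj. 1.2 and §3] -/
theorem doorIndexLawFullCAtTwo_iff_halves
    (hGZ : ∀ (N : ℕ) [NeZero N] (W : WeierstrassCurve ℚ) (K : Type) [Field K] [NumberField K], gross_zagier N W K)
    (hKo : ∀ (N : ℕ) [NeZero N] (W : WeierstrassCurve ℚ) (K : Type) [Field K] [NumberField K], kolyvagin N W K)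
    (hnf : exists_isNewformOf) :
    DoorIndexLawFullCAtTwo ↔ DoorIndexLawUpperCAtTwo ∧ DoorIndexLawLowerCAtTwo :=
  ⟨fun h => ⟨doorIndexLawUpperCAtTwo_of_full hGZ hKo hnf h, doorIndexLawLowerCAtTwo_of_full hGZ hKo hnf h⟩,
    fun h => doorIndexLawFullCAtTwo_of_halves hGZ hKo hnf h.1 h.2⟩

end Summit.BirchSwinnertonDyer.BirchSwinnertonDyer.Theorems.RankOneAtTwoOneDoor

end
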